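import Literature.NumberTheory.GaloisRepresentations.InertiaLift
import Literature.NumberTheory.GaloisRepresentations.AbsGaloisGroupCompact
import Literature.NumberTheory.GaloisRepresentations.RamificationFiltration
import HarnessLib

/-!
# Inertia surjects onto inertia for `Gal(K̄/K)`, in every characteristic (trunk GalRep)

For a field `K` (any characteristic), a commutative ring `R → K`, a prime `𝔓` of
`\bar R = absIntegers R K` (the integral closure of `R` in `K̄`) and a finite normal subextension
`E/K` of `K̄` with `𝔓_E = 𝔓 ∩ E`, **every element of the inertia group `I(𝔓_E) ≤ Aut(E/K)` is
the restriction of an element of the absolute inertia group `I_𝔓 ≤ Gal(K̄/K)`**: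

* `Literature.NumberTheory.GaloisRepresentations.inertia_comap_le_map_absRestrictNormalHom` — `I(𝔓_E) ≤ I_𝔓|_E`;
* `Literature.NumberTheory.GaloisRepresentations.inertia_comap_eq_map_absRestrictNormalHom` — `I(𝔓_E) = I_𝔓|_E` (the inclusion `≥` is the
  equivariance of `integralClosure R E → \bar R`).

This is Serre, *Local Fields*, Ch. I §7, Prop. 22 (b) (exactness of `T(L/K) → T(E/K) → 1`) for
the infinite extension `K̄/K`.  The characteristic-`0` case is
`ArtinConductorIntegrality.inertia_comap_le_range_absRestrictNormalHom`, deduced from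
`inertia_comap_le_map_restrictNormalHom` for a *Galois* `L/K`; `K̄/K` is not Galois when `K` is
imperfect (e.g. a local field of characteristic `p`), and the present file removes that
hypothesis.  The proof runs Mathlib's profinite Frobenius machinery packaged in
`Literature.NumberTheory.GaloisRepresentations.exists_mul_mul_mem_inertia` (file `InertiaLift`) for the compact (`AbsGaloisGroupCompact`)
totally disconnected group `Aut_K(K̄)` acting continuously on the discrete ring `\bar R`, with the
closed subgroup `N = Gal(K̄/E)`.  The one new point is the verification that a lift `g₀` of
`g ∈ I(𝔓_E)` acts as inertia on the `N`-invariants `b` of `\bar R`, which in characteristic `p`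
need not lie in `E`: but `b^{qⁿ}` is separable over `K` for some `n` (`K̄/K^{sep}` is purely
inseparable), it is fixed by `Gal(K̄/E) = Gal(K̄/E ∩ K^{sep})`
(`Literature.NumberTheory.GaloisRepresentations.fixingSubgroup_inf_separableClosure`), hence lies in `E ∩ K^{sep}` by Galois theory of
`K^{sep}/K` (`InfiniteGalois.fixedField_fixingSubgroup`), so `g₀ b^{qⁿ} - b^{qⁿ} ∈ 𝔓` and
`(g₀ b - b)^{qⁿ} ∈ 𝔓`, `g₀ b - b ∈ 𝔓`.

## References

* J.-P. Serre, *Local Fields*, GTM 67 (1979), Ch. I §7, Prop. 22 (b). [SerreLocalFields1979]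
* J. Neukirch, *Algebraic Number Theory* (1999), Ch. II §9, (9.4)–(9.5); Ch. IV §1.
  [NeukirchANT1999]
-/

noncomputable section

open scoped Pointwise
open Field

namespace Literature.NumberTheory.GaloisRepresentations

section Separable

variable (K : Type*) [Field K]

/-- **`Gal(K̄ / E ∩ K^{sep}) = Gal(K̄ / E)`** for every subfield `E` of `K̄/K`: an automorphism of
`K̄/K` fixing the separable part `E ∩ K^{sep}` of `E` pointwise fixes `E` pointwise, because
`K̄/K^{sep}` is purely inseparable (`x^{qⁿ} ∈ K^{sep}` and `q`-th roots are unique).  (The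
inclusion `≤` for a local field is `TameInertiaProofs.mem_fixingSubgroup_of_mem_fixingSubgroup_inf_separableClosure`.)
Ref: Neukirch, *Algebraic Number Theory*, Ch. IV §1. [folklore] -/
theorem fixingSubgroup_inf_separableClosure (E : IntermediateField K (AlgebraicClosure K)) :
    (E ⊓ separableClosure K (AlgebraicClosure K)).fixingSubgroup = E.fixingSubgroup := by
  refine le_antisymm (fun σ hσ => ?_) (IntermediateField.fixingSubgroup_antitone inf_le_left)
  rw [IntermediateField.mem_fixingSubgroup_iff] at hσ ⊢
  intro x hx
  set L := separableClosure K (AlgebraicClosure K) with hL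
  set q := ringExpChar L with hq
  haveI : ExpChar (AlgebraicClosure K) q :=
    expChar_of_injective_algebraMap (algebraMap L (AlgebraicClosure K)).injective q
  obtain ⟨n, y, hy⟩ := IsPurelyInseparable.pow_mem L q x
  have hmem : x ^ q ^ n ∈ E ⊓ L := by
    refine ⟨pow_mem hx _, ?_⟩
    rw [← hy]
    exact y.2
  have hfix : σ (x ^ q ^ n) = x ^ q ^ n := hσ _ hmem
  rw [map_pow] at hfix
  have h0 : (σ x - x) ^ q ^ n = 0 := by rw [sub_pow_expChar_pow, hfix, sub_self]
  exact sub_eq_zero.mp (pow_eq_zero_iff (pow_ne_zero n (expChar_pos (AlgebraicClosure K) q).ne') |>.mp h0)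

/-- An element of `K^{sep}` fixed by `Gal(K̄/E)` lies in `E` (Galois theory of `K^{sep}/K`:
`Gal(K̄/K) → Gal(K^{sep}/K)` is onto and `Gal(K̄/E) = Gal(K̄/E ∩ K^{sep})`).
Ref: Neukirch, *Algebraic Number Theory*, Ch. IV §1, (1.2). [folklore] -/
theorem mem_of_mem_separableClosure_of_forall_smul_eq (E : IntermediateField K (AlgebraicClosure K))
    {y : AlgebraicClosure K} (hyL : y ∈ separableClosure K (AlgebraicClosure K))
    (hy : ∀ σ ∈ E.fixingSubgroup, σ y = y) : y ∈ E := by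
  set L := separableClosure K (AlgebraicClosure K) with hL
  set M : IntermediateField K L := IntermediateField.restrict (inf_le_right : E ⊓ L ≤ L) with hM
  suffices hyM : (⟨y, hyL⟩ : L) ∈ M from ((IntermediateField.mem_restrict _ _).mp hyM).1
  rw [← InfiniteGalois.fixedField_fixingSubgroup M, IntermediateField.mem_fixedField_iff]
  intro φ hφ
  obtain ⟨φ', hφ'⟩ :=
    AlgEquiv.restrictNormalHom_surjective (F := K) (K₁ := L) (AlgebraicClosure K) φ
  have hφ'N : φ' ∈ E.fixingSubgroup := by
    rw [← fixingSubgroup_inf_separableClosure K E, IntermediateField.mem_fixingSubgroup_iff]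
    intro x hx
    have hxM : (⟨x, hx.2⟩ : L) ∈ M := (IntermediateField.mem_restrict _ _).mpr hx
    have h1 := (M.mem_fixingSubgroup_iff φ).mp hφ ⟨x, hx.2⟩ hxM
    have h2 := AlgEquiv.restrictNormalHom_apply L φ' ⟨x, hx.2⟩
    rw [hφ', h1] at h2
    exact h2.symm
  have h3 := AlgEquiv.restrictNormalHom_apply L φ' ⟨y, hyL⟩
  rw [hφ', hy φ' hφ'N] at h3
  exact Subtype.ext h3

end Separable

section Inertia

variable {K : Type*} [Field K] {R : Type*} [CommRing R] [Algebra R K]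

/-- **Inertia surjects onto inertia, every characteristic** (Serre I §7 Prop. 22 (b) for
`K̄/E/K`): for a prime `𝔓` of `\bar R = absIntegers R K` and a finite normal subextension `E/K` of
`K̄`, every element of the inertia group `I(𝔓 ∩ E) ≤ Aut(E/K)` is the restriction of an element
of the absolute inertia group `I_𝔓 ≤ Gal(K̄/K)`.  Proof: lift `g` to `g₀ ∈ Aut_K(K̄)`; for an
invariant `b` of `N = Gal(K̄/E)` in `\bar R`, some `b^{qⁿ}` is separable over `K`, hence in `E`
(`mem_of_mem_separableClosure_of_forall_smul_eq`), so `g₀ b^{qⁿ} - b^{qⁿ} ∈ 𝔓` and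
`g₀ b - b ∈ 𝔓` (`𝔓` is radical); then `Literature.NumberTheory.GaloisRepresentations.exists_mul_mul_mem_inertia` (compactness of
`Aut_K(K̄)`: `compactSpace_algebraicClosure_algEquiv`) corrects `g₀` into `I_𝔓` by elements of
`N` on both sides.
Ref: Serre, *Local Fields*, Ch. I §7, Prop. 22 (b); Neukirch, *Algebraic Number Theory*, Ch. II
§9, (9.5). [cite: SerreLocalFields1979, Ch. I §7 Prop. 22(b)] -/
theorem inertia_comap_le_map_absRestrictNormalHom (𝔓 : Ideal (absIntegers R K)) [𝔓.IsPrime]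
    (E : IntermediateField K (AlgebraicClosure K)) [FiniteDimensional K E] [Normal K E] :
    (𝔓.comap (E.integralClosureToAbsIntegers R)).inertia (E ≃ₐ[K] E) ≤
      (𝔓.inertia (absoluteGaloisGroup K)).map (absRestrictNormalHom E) := by
  classical
  intro g hg
  rw [Ideal.inertia, AddSubgroup.mem_inertia] at hg
  -- profinite set-up for `Aut_K(K̄)` acting on `\bar R`
  letI : TopologicalSpace (absIntegers R K) := ⊥
  haveI : DiscreteTopology (absIntegers R K) := ⟨rfl⟩
  haveI : ContinuousSMul (AlgebraicClosure K ≃ₐ[K] AlgebraicClosure K) (absIntegers R K) :=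
    continuousSMul_iff_stabilizer_isOpen.mpr (Literature.NumberTheory.GaloisRepresentations.stabilizer_integralClosure_isOpen R)
  haveI : CompactSpace (AlgebraicClosure K ≃ₐ[K] AlgebraicClosure K) :=
    compactSpace_algebraicClosure_algEquiv K
  let N : Subgroup (AlgebraicClosure K ≃ₐ[K] AlgebraicClosure K) := E.fixingSubgroup
  have hN : IsClosed (N : Set (AlgebraicClosure K ≃ₐ[K] AlgebraicClosure K)) :=
    IntermediateField.fixingSubgroup_isClosed E
  -- lift `g` to `K̄`
  obtain ⟨g₀, hg₀⟩ :=
    AlgEquiv.restrictNormalHom_surjective (F := K) (K₁ := E) (AlgebraicClosure K) g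
  -- the exponential characteristic
  set L := separableClosure K (AlgebraicClosure K) with hL
  set q := ringExpChar L with hq
  haveI hqK : ExpChar (AlgebraicClosure K) q :=
    expChar_of_injective_algebraMap (algebraMap L (AlgebraicClosure K)).injective q
  haveI : ExpChar (absIntegers R K) q :=
    RingHom.expChar (algebraMap (absIntegers R K) (AlgebraicClosure K)) Subtype.val_injective q
  -- `g₀` acts as inertia on the `N`-invariants of `\bar R`
  have hg₀inv : ∀ b : absIntegers R K, (∀ n ∈ N, n • b = b) → g₀ • b - b ∈ 𝔓 := by
    intro b hb
    obtain ⟨n, y, hy⟩ := IsPurelyInseparable.pow_mem L q (b : AlgebraicClosure K)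
    replace hy : (y : AlgebraicClosure K) = (b : AlgebraicClosure K) ^ q ^ n := hy
    -- `y = b ^ q ^ n` is separable over `K` and fixed by `N`, hence lies in `E`
    have hyE : (y : AlgebraicClosure K) ∈ E := by
      refine mem_of_mem_separableClosure_of_forall_smul_eq K E y.2 fun σ hσ => ?_
      rw [hy, map_pow]
      have := congrArg (fun c : absIntegers R K => (c : AlgebraicClosure K)) (hb σ hσ)
      simp only [integralClosure.coe_smul] at this
      rw [AlgEquiv.smul_def] at this
      rw [this]
    have hyint : IsIntegral R (⟨(y : AlgebraicClosure K), hyE⟩ : E) := by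
      rw [← isIntegral_algHom_iff (E.val.restrictScalars R)
        (show Function.Injective (E.val.restrictScalars R) from fun _ _ h => Subtype.ext h)]
      change IsIntegral R (y : AlgebraicClosure K)
      rw [hy]
      exact (b ^ q ^ n).2
    set x : integralClosure R E := ⟨⟨(y : AlgebraicClosure K), hyE⟩, hyint⟩ with hxdef
    have hbx : b ^ q ^ n = E.integralClosureToAbsIntegers R x := Subtype.ext (by
      change ((b : AlgebraicClosure K)) ^ q ^ n = y
      exact hy.symm)
    have hgx : g • x - x ∈ 𝔓.comap (E.integralClosureToAbsIntegers R) := hg x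
    have key := E.integralClosureToAbsIntegers_restrictNormalHom_smul R
      ((absoluteGaloisGroup.toAlgEquiv K).symm g₀) x
    rw [MulEquiv.apply_symm_apply] at key
    rw [Ideal.mem_comap, map_sub, ← hg₀, key, ← hbx] at hgx
    -- `hgx : (toAlgEquiv K).symm g₀ • b ^ q ^ n - b ^ q ^ n ∈ 𝔓`
    have hpow : (g₀ • b - b) ^ q ^ n ∈ 𝔓 := by
      rw [sub_pow_expChar_pow, ← smul_pow']
      exact hgx
    exact Ideal.IsPrime.mem_of_pow_mem ‹_› _ hpow
  obtain ⟨n, hn, n', hn', hσ⟩ := exists_mul_mul_mem_inertia N hN 𝔓 g₀ hg₀inv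
  refine ⟨(absoluteGaloisGroup.toAlgEquiv K).symm (n * g₀ * n'), hσ, ?_⟩
  have h1 : AlgEquiv.restrictNormalHom E n = 1 := by
    rw [← MonoidHom.mem_ker, IntermediateField.restrictNormalHom_ker]
    exact hn
  have h2 : AlgEquiv.restrictNormalHom E n' = 1 := by
    rw [← MonoidHom.mem_ker, IntermediateField.restrictNormalHom_ker]
    exact hn'
  change AlgEquiv.restrictNormalHom E
      (absoluteGaloisGroup.toAlgEquiv K ((absoluteGaloisGroup.toAlgEquiv K).symm (n * g₀ * n'))) = g
  rw [MulEquiv.apply_symm_apply, map_mul, map_mul, hg₀, h1, h2, one_mul, mul_one]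

/-- **`I(𝔓 ∩ E) = I_𝔓|_E`**: the inertia group of `𝔓 ∩ E` in `Aut(E/K)` is exactly the image of
the absolute inertia group `I_𝔓 ≤ Gal(K̄/K)` under restriction (`≤`:
`inertia_comap_le_map_absRestrictNormalHom`; `≥`: equivariance of `integralClosure R E → \bar R`,
cf. `ArtinConductorIntegrality.inertia_map_absRestrictNormalHom_le`).
Ref: Serre, *Local Fields*, Ch. I §7, Prop. 22 (b). [cite: SerreLocalFields1979, Ch. I §7 Prop. 22(b)] -/
theorem inertia_comap_eq_map_absRestrictNormalHom (𝔓 : Ideal (absIntegers R K)) [𝔓.IsPrime]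
    (E : IntermediateField K (AlgebraicClosure K)) [FiniteDimensional K E] [Normal K E] :
    (𝔓.comap (E.integralClosureToAbsIntegers R)).inertia (E ≃ₐ[K] E) =
      (𝔓.inertia (absoluteGaloisGroup K)).map (absRestrictNormalHom E) := by
  refine le_antisymm (inertia_comap_le_map_absRestrictNormalHom 𝔓 E) ?_
  rintro _ ⟨σ, hσ, rfl⟩
  replace hσ : σ ∈ 𝔓.inertia (absoluteGaloisGroup K) := hσ
  rw [Ideal.inertia, AddSubgroup.mem_inertia] at hσ ⊢
  intro x
  change E.integralClosureToAbsIntegers R (absRestrictNormalHom E σ • x - x) ∈ 𝔓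
  rw [map_sub]
  change E.integralClosureToAbsIntegers R
      (AlgEquiv.restrictNormalHom E (absoluteGaloisGroup.toAlgEquiv K σ) • x) -
    E.integralClosureToAbsIntegers R x ∈ 𝔓
  rw [E.integralClosureToAbsIntegers_restrictNormalHom_smul R σ x]
  exact hσ _

/-- Pointwise form: every `g ∈ I(𝔓 ∩ E)` is `σ|_E` for some `σ ∈ I_𝔓`.
Ref: Serre, *Local Fields*, Ch. I §7, Prop. 22 (b). [cite: SerreLocalFields1979, Ch. I §7 Prop. 22(b)] -/
theorem exists_mem_inertia_absRestrictNormalHom_eq (𝔓 : Ideal (absIntegers R K)) [𝔓.IsPrime]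
    (E : IntermediateField K (AlgebraicClosure K)) [FiniteDimensional K E] [Normal K E]
    {g : E ≃ₐ[K] E} (hg : g ∈ (𝔓.comap (E.integralClosureToAbsIntegers R)).inertia (E ≃ₐ[K] E)) :
    ∃ σ ∈ 𝔓.inertia (absoluteGaloisGroup K), absRestrictNormalHom E σ = g :=
  inertia_comap_le_map_absRestrictNormalHom 𝔓 E hg

end Inertia

end Literature.NumberTheory.GaloisRepresentations
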